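import Summits.Ventures.Crystal3D.Bulk.RotSysConvexFaces
import Summits.Ventures.Crystal3D.Bulk.GapSubHullEuler
import Summits.Ventures.Crystal3D.Bulk.GapSubHullCorners
import Summits.Ventures.Crystal3D.Bulk.GapActiveHull
import Summits.Ventures.Crystal3D.Bulk.HullRotSysCornerSign
import HarnessLib

/-!
# LEMMA L in the hull fan of a spherical code: faces of a connected spanning sub-map with
# corners `< π` are convex — and the census corollary for the oriented faces of the tight map
# (`HOME/lean/lemmaL/DESIGN.md` R1.7′, instantiation; a second, ear-free proof next to p3's
# ear induction `HullRotSys.faceConvex_of_cover`)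

HONEST FRAMING. Part of the venture `Summits/Ventures/Crystal3D` (cell `pub-crystal3d`, phase 2;
seat typer-bulk-2). Nothing here asserts anything about GAP(1.26). This file instantiates the
generic edge-insertion theorem `RotSys.IsRotSys.cw_face` (`Bulk/RotSysConvexFaces.lean`) at the
hull rotation system `(rot, inv)` of a finite `X ⊂ S²` with `0` interior to its hull
(`Bulk/HullRotSys*.lean`, weights = fan angles `dartWeight`, position of a dart = its tail):

* (BASE) discharged: `minimalPeriod_phi_univ` (every face of the full hull map is a triangle) and
  `cw_face_univ` (it is traversed clockwise: `orient3 (φ² d) (φ d) d > 0`, from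
  `isPosThird_succV`);
* (LINK) discharged by p3's `HullRotSys.orient3_pos_of_cornerAt_lt_pi`
  (`Bulk/HullRotSysCornerSign.lean`): a corner `< π` at the dart `y → b` followed at `y` by the
  dart `y → p` of `S` means `0 < orient3 y b p`;
* **`HullRotSys.cw_face_of_link`** — LEMMA L for every `inv`-closed connected dart set `S`
  meeting every vertex of `X` with all corners `< π`, with LINK as an explicit hypothesis (kept
  in this generality: any proof of LINK can be plugged), and **`HullRotSys.cw_face`** — the
  same, UNCONDITIONAL;
* **`CensusRows.cw_oface`** — the census corollary: at a census configuration `c`, in the hull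
  fan of the ACTIVE directions (`Bulk/GapActiveHull.lean`; every active vertex carries a tight
  dart, so the tight sub-map is spanning; it is connected by `CensusRows.tightConnected` and its
  corners are the oriented gaps `< π`, `CensusRows.cornerAt_tightDartsIn_lt_pi`), every oriented
  face walk `n ↦ gapDir c ((ofaceSucc c)^[n] q).1` of length `ofaceLen c q` is clockwise convex
  (`CensusRows.cw_oface_of_link`: the same with LINK at `X = activeDirSet c` as a hypothesis).

Convention of record: face walks are CLOCKWISE seen from outside, so LEMMA L reads
`∀ i < j < k, 0 < orient3 (v k) (v j) (v i)`; `Bulk/ClockwiseGluing.lean`'s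
`cw_iff_convexPos_rev` turns this into convex position of the reversed walk, the hypothesis of
the Literature's `sum_angle_lt_two_pi_of_orient3_pos` (face sizes, R1.8).
-/

noncomputable section

namespace Summit.Ventures.Crystal3D

open Literature.Geometry.DiscreteGeometry Finset Equiv Function

namespace HullRotSys

variable {X : Finset (EuclideanSpace ℝ (Fin 3))} {hX1 : ∀ y ∈ X, ‖y‖ = 1}
  {h0 : (0 : EuclideanSpace ℝ (Fin 3)) ∈ interior (convexHull ℝ (X : Set _))}

/-! ## (BASE): the faces of the full hull map are clockwise triangles -/

/-- Every dart of the full hull map has minimal period `3` under the face permutation. -/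
theorem minimalPeriod_phi_univ (d : ↥(hullDarts X)) :
    minimalPeriod (RotSys.phi (rot hX1 h0) (inv X) univ) d = 3 := by
  classical
  have h2 := (isRotSys (hX1 := hX1) (h0 := h0)).two_le_minimalPeriod_phi univ d
  have hper : IsPeriodicPt (RotSys.phi (rot hX1 h0) (inv X) univ) 3 d := by
    unfold IsPeriodicPt IsFixedPt
    rw [Equiv.Perm.iterate_eq_pow]
    exact phi_univ_pow_three d
  have hle := hper.minimalPeriod_le (by norm_num)
  have hdvd := hper.minimalPeriod_dvd
  set n := minimalPeriod (RotSys.phi (rot hX1 h0) (inv X) univ) d with hn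
  interval_cases n
  · exact absurd hdvd (by norm_num)
  · rfl

/-- **(BASE)** Every face walk of the full hull map is clockwise convex: its three vertices
`y, a, succV X a y` satisfy `0 < orient3 (succV X a y) a y`. -/
theorem cw_face_univ (d : ↥(hullDarts X)) :
    ∀ i j k : ℕ, i < j → j < k → k < minimalPeriod (RotSys.phi (rot hX1 h0) (inv X) univ) d →
      0 < orient3 ((RotSys.phi (rot hX1 h0) (inv X) univ ^ k) d).1.1
        ((RotSys.phi (rot hX1 h0) (inv X) univ ^ j) d).1.1
        ((RotSys.phi (rot hX1 h0) (inv X) univ ^ i) d).1.1 := by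
  intro i j k hij hjk hk
  rw [minimalPeriod_phi_univ] at hk
  have hi : i = 0 := by omega
  have hj : j = 1 := by omega
  have hk' : k = 2 := by omega
  subst hi hj hk'
  obtain ⟨⟨y, a⟩, hd⟩ := d
  rw [phi_univ_pow_apply, phi_univ_pow_apply, pow_zero, Perm.one_apply]
  simp only [Function.iterate_succ_apply', Function.iterate_zero_apply, hullFace_mk]
  have hP := isPosThird_succV hX1 h0 (swap_mem_hullDarts hd)
  rw [orient3_cyclic]
  exact hP.2

/-- The fan-angle weights are non-negative (local copy; the public lemma is p3's
`HullRotSys.dartWeight_nonneg` in `Bulk/HullFaceWalk.lean`). -/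
private theorem fanWeight_nonneg (d : ↥(hullDarts X)) : 0 ≤ dartWeight X d := by
  rw [dartWeight_apply]; exact InnerProductGeometry.angle_nonneg _ _

/-! ## LEMMA L in the hull fan, modulo LINK -/

/-- **LEMMA L for sub-maps of the hull fan, modulo the LINK LEMMA.** Let `X ⊂ S²` be finite with
`0` interior to its hull, and assume LINK for `X` (`hlink`). Then for every `inv`-closed dart
set `S` with one component, meeting every vertex of `X`, all of whose corners (fan-angle sums to
the next dart of `S`) are `< π`, and every `x ∈ S`, the face walk `n ↦ tail (φ_S^n x)` of length
`minimalPeriod φ_S x` is clockwise convex. -/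
theorem cw_face_of_link
    (hlink : ∀ S : Finset ↥(hullDarts X), RotSys.IsClosed (inv X) S → ∀ z ∈ S,
      RotSys.cornerAt (rot hX1 h0) (dartWeight X) S z < Real.pi →
      0 < orient3 z.1.1 z.1.2 (RotSys.induce (rot hX1 h0) S z).1.2)
    {S : Finset ↥(hullDarts X)} (hS : RotSys.IsClosed (inv X) S)
    (hK : RotSys.numK (rot hX1 h0) (inv X) S = 1) (hspan : ∀ y ∈ X, ∃ z ∈ S, z.1.1 = y)
    (hcorner : ∀ z ∈ S, RotSys.cornerAt (rot hX1 h0) (dartWeight X) S z < Real.pi)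
    {x : ↥(hullDarts X)} (hx : x ∈ S) :
    ∀ i j k : ℕ, i < j → j < k → k < minimalPeriod (RotSys.phi (rot hX1 h0) (inv X) S) x →
      0 < orient3 ((RotSys.phi (rot hX1 h0) (inv X) S ^ k) x).1.1
        ((RotSys.phi (rot hX1 h0) (inv X) S ^ j) x).1.1
        ((RotSys.phi (rot hX1 h0) (inv X) S ^ i) x).1.1 := by
  classical
  have hpos : ∀ d : ↥(hullDarts X), (rot hX1 h0 d).1.1 = d.1.1 := fun d => rfl
  have hlink' : ∀ S : Finset ↥(hullDarts X), RotSys.IsClosed (inv X) S → ∀ z ∈ S,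
      RotSys.cornerAt (rot hX1 h0) (dartWeight X) S z < Real.pi →
      0 < orient3 z.1.1 (inv X z).1.1 (inv X (RotSys.induce (rot hX1 h0) S z)).1.1 :=
    fun S hS z hz hc => hlink S hS z hz hc
  have hspan' : ∀ d : ↥(hullDarts X), ∃ z ∈ S, (rot hX1 h0).SameCycle d z := by
    intro d
    obtain ⟨z, hz, he⟩ := hspan d.1.1 (fst_mem_of_mem_hullDarts hX1 d.2)
    exact ⟨z, hz, (sameCycle_rot_iff d z).2 he.symm⟩
  exact (isRotSys (hX1 := hX1) (h0 := h0)).cw_face (pos := fun d => d.1.1) chi2_univ_eq_numK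
    hpos fanWeight_nonneg hlink' cw_face_univ hS hK hspan' hcorner hx

/-- **LEMMA L for sub-maps of the hull fan** (unconditional: LINK is p3's
`orient3_pos_of_cornerAt_lt_pi`). For `X ⊂ S²` finite with `0` interior to its hull, every
`inv`-closed dart set `S` with one component, meeting every vertex of `X`, all of whose corners
are `< π`, has clockwise-convex face walks. -/
theorem cw_face {S : Finset ↥(hullDarts X)} (hS : RotSys.IsClosed (inv X) S)
    (hK : RotSys.numK (rot hX1 h0) (inv X) S = 1) (hspan : ∀ y ∈ X, ∃ z ∈ S, z.1.1 = y)
    (hcorner : ∀ z ∈ S, RotSys.cornerAt (rot hX1 h0) (dartWeight X) S z < Real.pi)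
    {x : ↥(hullDarts X)} (hx : x ∈ S) :
    ∀ i j k : ℕ, i < j → j < k → k < minimalPeriod (RotSys.phi (rot hX1 h0) (inv X) S) x →
      0 < orient3 ((RotSys.phi (rot hX1 h0) (inv X) S ^ k) x).1.1
        ((RotSys.phi (rot hX1 h0) (inv X) S ^ j) x).1.1
        ((RotSys.phi (rot hX1 h0) (inv X) S ^ i) x).1.1 :=
  cw_face_of_link (fun S _ _ hz hc => orient3_pos_of_cornerAt_lt_pi S hz hc) hS hK hspan hcorner hx

end HullRotSys

/-! ## The census corollary: oriented faces of the tight map, in the active hull -/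

open HullRotSys

variable {c : Fin 14 → EuclideanSpace ℝ (Fin 3)}

/-- **LEMMA L at a census configuration, modulo the LINK LEMMA for the active hull.** For a
configuration `c` with `CensusRows c` and a tight dart `q`, the oriented face walk
`n ↦ gapDir c ((ofaceSucc c)^[n] q).1` (length `ofaceLen c q`) is clockwise convex:
`0 < orient3 (v k) (v j) (v i)` for `i < j < k < ofaceLen c q` — provided LINK holds in the hull
fan of `activeDirSet c`. -/
theorem CensusRows.cw_oface_of_link (h : CensusRows c)
    (hlink : ∀ S : Finset ↥(hullDarts (activeDirSet c)), RotSys.IsClosed (inv (activeDirSet c)) S →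
      ∀ z ∈ S, RotSys.cornerAt (rot h.isGapConfig.norm_of_mem_activeDirSet
        h.zero_mem_interior_convexHull_activeDirSet) (dartWeight (activeDirSet c)) S z < Real.pi →
      0 < orient3 z.1.1 z.1.2 (RotSys.induce (rot h.isGapConfig.norm_of_mem_activeDirSet
        h.zero_mem_interior_convexHull_activeDirSet) S z).1.2)
    {q : Fin 14 × Fin 14} (hq : q ∈ darts c) :
    ∀ i j k : ℕ, i < j → j < k → k < ofaceLen c q →
      0 < orient3 (gapDir c ((ofaceSucc c)^[k] q).1) (gapDir c ((ofaceSucc c)^[j] q).1)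
        (gapDir c ((ofaceSucc c)^[i] q).1) := by
  classical
  have hc := h.isGapConfig
  have hD := h.intruderDist_lt_three_halves
  have hD2 : intruderDist c < 2 := by linarith
  have hD3 := hc.sq_lt_three_of_lt hD
  have hX1 := hc.norm_of_mem_activeDirSet
  have h0 := h.zero_mem_interior_convexHull_activeDirSet
  have hT := h.dirPair_mem_hullDarts_active
  set X := activeDirSet c with hX
  set S := tightDartsIn c X with hS_def
  set d : ↥(hullDarts X) := ⟨dirPair c q, hT q hq⟩ with hd_def
  have hd : d.1 = dirPair c q := rfl
  have hdS : d ∈ S := mem_tightDartsIn.2 ⟨q, hq, rfl⟩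
  -- the hypotheses of `cw_face_of_link`
  have hS : RotSys.IsClosed (inv X) S := isClosed_tightDartsIn c X
  have hK : RotSys.numK (rot hX1 h0) (inv X) S = 1 :=
    hc.numK_eq_one_of_tightConnected_of hX1 h0 hT h.tightConnected h.darts_nonempty
  have hspan : ∀ y ∈ X, ∃ z ∈ S, z.1.1 = y := by
    intro y hy
    obtain ⟨i, hi, rfl⟩ := mem_activeDirSet.1 hy
    obtain ⟨hi0, ⟨j, hj⟩⟩ := mem_activeVertices.1 hi
    have hq' : (i, j) ∈ darts c := mk_mem_darts hi0 hj
    exact ⟨⟨dirPair c (i, j), hT _ hq'⟩, mem_tightDartsIn.2 ⟨(i, j), hq', rfl⟩, rfl⟩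
  have hcorner : ∀ z ∈ S, RotSys.cornerAt (rot hX1 h0) (dartWeight X) S z < Real.pi :=
    fun z hz => h.cornerAt_tightDartsIn_lt_pi hX1 h0 hT hz
  have key := cw_face_of_link (hX1 := hX1) (h0 := h0) hlink hS hK hspan hcorner hdS
  -- translate: iterates are `dirPair c (φ°^[n] q)`, the period is `ofaceLen c q`
  have hval : ∀ n, ((RotSys.phi (rot hX1 h0) (inv X) S ^ n) d).1.1 =
      gapDir c ((ofaceSucc c)^[n] q).1 := by
    intro n
    rw [hc.phi_pow_rot_val_of hD hX1 h0 hT hq hd n]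
    rfl
  have hperiod : minimalPeriod (RotSys.phi (rot hX1 h0) (inv X) S) d = ofaceLen c q := by
    -- the two dynamics have the same periodic points through `n ↦ dirPair c (φ°^[n] q)`
    have hiff : ∀ n, IsPeriodicPt (RotSys.phi (rot hX1 h0) (inv X) S) n d ↔
        IsPeriodicPt (ofaceSucc c) n q := by
      intro n
      unfold IsPeriodicPt IsFixedPt
      rw [Equiv.Perm.iterate_eq_pow, Subtype.ext_iff, hc.phi_pow_rot_val_of hD hX1 h0 hT hq hd n,
        hd]
      constructor
      · intro he
        exact hc.dirPair_injOn hD2 (Finset.mem_coe.2 (hc.iterate_ofaceSucc_mem_darts hD3 hq n))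
          (Finset.mem_coe.2 hq) he
      · intro he; rw [he]
    apply Nat.dvd_antisymm
    · exact ((hiff _).2 (isPeriodicPt_minimalPeriod _ _)).minimalPeriod_dvd
    · exact ((hiff _).1 (isPeriodicPt_minimalPeriod _ _)).minimalPeriod_dvd
  intro i j k hij hjk hk
  rw [← hval, ← hval, ← hval]
  exact key i j k hij hjk (by rw [hperiod]; exact hk)

/-- **LEMMA L at a census configuration** (unconditional). For `c` with `CensusRows c` and a
tight dart `q`, the oriented face walk `n ↦ gapDir c ((ofaceSucc c)^[n] q).1` of length
`ofaceLen c q` is clockwise convex: `0 < orient3 (v k) (v j) (v i)` for all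
`i < j < k < ofaceLen c q` — every oriented face of the tight map is a convex spherical polygon
(read clockwise from outside). -/
theorem CensusRows.cw_oface (h : CensusRows c) {q : Fin 14 × Fin 14} (hq : q ∈ darts c) :
    ∀ i j k : ℕ, i < j → j < k → k < ofaceLen c q →
      0 < orient3 (gapDir c ((ofaceSucc c)^[k] q).1) (gapDir c ((ofaceSucc c)^[j] q).1)
        (gapDir c ((ofaceSucc c)^[i] q).1) :=
  h.cw_oface_of_link (fun S _ _ hz hc => orient3_pos_of_cornerAt_lt_pi S hz hc) hq

end Summit.Ventures.Crystal3D

end
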